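import Mathlib
import HarnessLib

/-!
# The slot (permutation) model of a bounded-degree graph: degrees, connectivity, cut events

The non-constructive existence of bounded-degree EXPANDERS (Pinsker 1973; for the edge version,
the isoperimetric number `i(G) = min_{|S| ≤ n/2} |e(S, V∖S)|/|S|` of random regular graphs,
Bollobás 1988; surveys: [Chung1997] §6.1 "the probabilistic method … only guarantees the
existence of an expander" (PDF pp. 71–72), §2; F. Chung, *Constructing random-like graphs*, in
Bollobás (ed.), *Probabilistic Combinatorics and Its Applications* (1991), §2 (PDF p. 36:
definition of `i(G)`), Cor. 3.1) is proved in this directory by COUNTING, in the permutation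
model of [BurgisserClausenShokrollahi1997] Lemma (13.32) already used in
`BoundedConcentrator.lean`, here with inputs = outputs: a permutation `π` of the SLOTS
`Fin N × Fin d` (vertex `x` owns the slots `(x, c)`) joins `x` to the owner of `π (x, c)` for
every `c`; we add the Hamiltonian path `0 — 1 — ⋯ — (N-1)` for connectivity. No definition is
introduced: every lemma is stated for an arbitrary graph `G` whose adjacency is the slot
adjacency (hypothesis `hG`).

This file (deterministic part):
* `card_le_card_image_add_card_collisions` — a map is injective up to its ordered colliding
  pairs: `|s| ≤ |f(s)| + #{(a,b) ∈ s², a ≠ b, f a = f b}`;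
* `degree_le_of_slotGraph` (`≤ 2d + 2`), `connected_of_slotGraph`;
* `card_cutEvents_le` — the CUT EVENTS of `U` (slots of `U` sent to slots owned outside `U`)
  number at most the ordered cut pairs `(x ∈ U, y ∉ U, x ~ y)` plus the MULTI-EDGE triples
  `(x, c, c')`, `c ≠ c'`, both slots sent to slots of one vertex;
  `card_cutEvents_add_card_inner`, `card_inner_lt_of_not_bad`.
The counting half is `SlotGraphCounting.lean`; the expander is assembled in `EdgeExpander.lean`.

## References
* [Chung1997] F. R. K. Chung, *Spectral Graph Theory* (1997), §6.1, §2 — held.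
* [BurgisserClausenShokrollahi1997] §13.4, Lemma (13.32) (the permutation model) — held.
* M. Pinsker, On the complexity of a concentrator, 7th Int. Teletraffic Conf. (1973) — cited
  via [Chung1997] ref. [211]; B. Bollobás, The isoperimetric number of random regular graphs,
  Eur. J. Combin. 9 (1988) — not held (statement level only; nothing here depends on them).
-/

namespace Literature.Combinatorics.Expanders

open Finset

/-! ### A counting lemma: a map is injective up to its colliding pairs -/

/-- `|s| ≤ |f(s)| + #{(a,b) ∈ s × s : a ≠ b, f a = f b}`: every fibre of size `m ≥ 1` contributes
`1` to the image and `m(m-1) ≥ m-1` ordered colliding pairs. [folklore] -/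
theorem card_le_card_image_add_card_collisions {α β : Type*} [DecidableEq α] [DecidableEq β]
    (s : Finset α) (f : α → β) :
    s.card ≤ (s.image f).card +
      ((s ×ˢ s).filter fun ab : α × α => ab.1 ≠ ab.2 ∧ f ab.1 = f ab.2).card := by
  classical
  induction s using Finset.induction_on with
  | empty => simp
  | insert a s ha ih =>
    rw [card_insert_of_notMem ha]
    have hmono : ((s ×ˢ s).filter fun ab : α × α => ab.1 ≠ ab.2 ∧ f ab.1 = f ab.2) ⊆
        ((insert a s ×ˢ insert a s).filter fun ab : α × α => ab.1 ≠ ab.2 ∧ f ab.1 = f ab.2) := by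
      apply filter_subset_filter
      exact product_subset_product (subset_insert _ _) (subset_insert _ _)
    by_cases hfa : f a ∈ s.image f
    · -- the image does not grow, but a new colliding pair `(a, b)` appears
      obtain ⟨b, hb, hfb⟩ := mem_image.1 hfa
      have hab : a ≠ b := fun h => ha (h ▸ hb)
      have hpair : (a, b) ∈ ((insert a s ×ˢ insert a s).filter
          fun ab : α × α => ab.1 ≠ ab.2 ∧ f ab.1 = f ab.2) := by
        simp only [mem_filter, mem_product, mem_insert, true_or, true_and]
        exact ⟨Or.inr hb, hab, hfb.symm⟩
      have hnot : (a, b) ∉ ((s ×ˢ s).filter fun ab : α × α => ab.1 ≠ ab.2 ∧ f ab.1 = f ab.2) := by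
        simp only [mem_filter, mem_product, not_and]
        intro h
        exact absurd h.1 ha
      have hlt : ((s ×ˢ s).filter fun ab : α × α => ab.1 ≠ ab.2 ∧ f ab.1 = f ab.2).card <
          ((insert a s ×ˢ insert a s).filter fun ab : α × α => ab.1 ≠ ab.2 ∧ f ab.1 = f ab.2).card :=
        card_lt_card ⟨hmono, fun h => hnot (h hpair)⟩
      rw [image_insert, insert_eq_of_mem hfa]
      omega
    · rw [image_insert, card_insert_of_notMem hfa]
      have := card_le_card hmono
      omega


/-! ### The slot model

A permutation `π` of the slots `Fin N × Fin d` (vertex `x` owns the slots `(x, c)`) defines the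
graph on `Fin N` joining `x` to the owners of the images of its slots; we add the Hamiltonian path
`0 — 1 — ⋯ — (N-1)` to make the graph connected. We never name this graph: the lemmas below are
stated for every `G` whose adjacency is characterised by `IsSlotGraph π G`. -/

section Model

variable {N d : ℕ}

/-- **Degree bound.** If `G` is the graph of the slot permutation `π` plus the path
`0 — 1 — ⋯ — (N-1)` (`x ~ y` iff `x ≠ y` and: some slot of `x` is sent to a slot of `y`, or vice
versa, or `|x - y| = 1` — the hypothesis `hG`; no definition is introduced), then every degree is
`≤ 2d + 2`: the neighbours of `v` are owners of the images of `v`'s `d` slots, owners of the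
preimages of `v`'s `d` slots, or `v ± 1`. [folklore] -/
theorem degree_le_of_slotGraph (π : Equiv.Perm (Fin N × Fin d)) (G : SimpleGraph (Fin N))
    [DecidableRel G.Adj]
    (hG : ∀ x y, G.Adj x y ↔ x ≠ y ∧ ((∃ c, (π (x, c)).1 = y ∨ (π (y, c)).1 = x) ∨
      x.val + 1 = y.val ∨ y.val + 1 = x.val))
    (v : Fin N) : G.degree v ≤ 2 * d + 2 := by
  classical
  -- neighbours ⊆ owners of the images of `v`'s slots ∪ owners of the preimages of `v`'s slots
  --            ∪ {v - 1, v + 1}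
  set A : Finset (Fin N) := univ.image fun c : Fin d => (π (v, c)).1 with hA
  set B : Finset (Fin N) := univ.image fun c : Fin d => (π.symm (v, c)).1 with hB
  set P : Finset (Fin N) := univ.filter fun w : Fin N => v.val + 1 = w.val ∨ w.val + 1 = v.val
    with hP
  have hsub : G.neighborFinset v ⊆ A ∪ B ∪ P := by
    intro w hw
    rw [SimpleGraph.mem_neighborFinset, hG] at hw
    obtain ⟨_, hw⟩ := hw
    rcases hw with ⟨c, hc | hc⟩ | hp
    · exact mem_union_left _ (mem_union_left _ (mem_image.2 ⟨c, mem_univ _, hc⟩))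
    · refine mem_union_left _ (mem_union_right _ (mem_image.2 ⟨(π (w, c)).2, mem_univ _, ?_⟩))
      have : π (w, c) = (v, (π (w, c)).2) := Prod.ext hc rfl
      rw [← this, Equiv.symm_apply_apply]
    · exact mem_union_right _ (mem_filter.2 ⟨mem_univ _, hp⟩)
  have hAc : A.card ≤ d := (card_image_le).trans (by simp)
  have hBc : B.card ≤ d := (card_image_le).trans (by simp)
  have hPc : P.card ≤ 2 := by
    have hinj : Set.InjOn (fun w : Fin N => w.val) P := fun x _ y _ h => Fin.ext h
    have himg : P.image (fun w : Fin N => w.val) ⊆ {v.val + 1, v.val - 1} := by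
      intro n hn
      obtain ⟨w, hw, rfl⟩ := mem_image.1 hn
      rw [hP, mem_filter] at hw
      rcases hw.2 with h | h
      · simp [h]
      · simp [← h]
    calc P.card = (P.image fun w : Fin N => w.val).card := (card_image_of_injOn hinj).symm
      _ ≤ ({v.val + 1, v.val - 1} : Finset ℕ).card := card_le_card himg
      _ ≤ 2 := card_le_two
  calc G.degree v = (G.neighborFinset v).card := (SimpleGraph.card_neighborFinset_eq_degree _ _).symm
    _ ≤ (A ∪ B ∪ P).card := card_le_card hsub
    _ ≤ (A ∪ B).card + P.card := card_union_le _ _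
    _ ≤ A.card + B.card + P.card := Nat.add_le_add_right (card_union_le _ _) _
    _ ≤ d + d + 2 := by omega
    _ = 2 * d + 2 := by ring

/-- The slot graph contains the path `0 — 1 — ⋯ — (N-1)`, hence is connected (`N ≥ 1`).
[folklore] -/
theorem connected_of_slotGraph (π : Equiv.Perm (Fin N × Fin d)) (G : SimpleGraph (Fin N))
    (hG : ∀ x y, G.Adj x y ↔ x ≠ y ∧ ((∃ c, (π (x, c)).1 = y ∨ (π (y, c)).1 = x) ∨
      x.val + 1 = y.val ∨ y.val + 1 = x.val))
    (hN : 1 ≤ N) : G.Connected := by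
  obtain ⟨n, rfl⟩ : ∃ n, N = n + 1 := ⟨N - 1, by omega⟩
  have hle : SimpleGraph.pathGraph (n + 1) ≤ G := by
    intro u w huw
    rw [SimpleGraph.pathGraph_adj] at huw
    rw [hG]
    refine ⟨?_, Or.inr huw⟩
    intro h
    subst h
    omega
  exact (SimpleGraph.pathGraph_connected n).mono hle

end Model

/-! ### Cut events of a vertex set -/

section Cut

variable {N d : ℕ}

/-- **Cut events give cut edges, up to multi-edges.** For the slot graph `G` of `π` and a vertex
set `U`, the slots `(x, c)` with `x ∈ U` whose image is owned outside `U` ("cut events") number at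
most the ordered cut pairs `(x, y)`, `x ∈ U`, `y ∉ U`, `x ~ y`, plus the number of ordered pairs of
distinct slots of one vertex with the same target owner (the multi-edges of the model).
[folklore] -/
theorem card_cutEvents_le (π : Equiv.Perm (Fin N × Fin d)) (G : SimpleGraph (Fin N))
    [DecidableRel G.Adj]
    (hG : ∀ x y, G.Adj x y ↔ x ≠ y ∧ ((∃ c, (π (x, c)).1 = y ∨ (π (y, c)).1 = x) ∨
      x.val + 1 = y.val ∨ y.val + 1 = x.val))
    (U : Finset (Fin N)) :
    ((U ×ˢ (univ : Finset (Fin d))).filter fun p => (π p).1 ∉ U).card ≤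
      ((U ×ˢ Uᶜ).filter fun e : Fin N × Fin N => G.Adj e.1 e.2).card +
      ((univ : Finset (Fin N × Fin d × Fin d)).filter fun t =>
        t.2.1 ≠ t.2.2 ∧ (π (t.1, t.2.1)).1 = (π (t.1, t.2.2)).1).card := by
  classical
  set E := (U ×ˢ (univ : Finset (Fin d))).filter fun p => (π p).1 ∉ U with hE
  let f : Fin N × Fin d → Fin N × Fin N := fun p => (p.1, (π p).1)
  have h1 := card_le_card_image_add_card_collisions E f
  -- the image consists of cut pairs
  have himg : E.image f ⊆ (U ×ˢ Uᶜ).filter fun e : Fin N × Fin N => G.Adj e.1 e.2 := by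
    intro e he
    obtain ⟨p, hp, rfl⟩ := mem_image.1 he
    rw [hE, mem_filter, mem_product] at hp
    obtain ⟨⟨hx, -⟩, hy⟩ := hp
    refine mem_filter.2 ⟨mem_product.2 ⟨hx, mem_compl.2 hy⟩, ?_⟩
    rw [hG]
    refine ⟨fun h => hy ?_, Or.inl ⟨p.2, Or.inl rfl⟩⟩
    change p.1 = (π p).1 at h
    rw [← h]
    exact hx
  -- colliding pairs are pairs of distinct slots of one vertex with the same target owner
  have hcoll : ((E ×ˢ E).filter fun ab => ab.1 ≠ ab.2 ∧ f ab.1 = f ab.2).card ≤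
      ((univ : Finset (Fin N × Fin d × Fin d)).filter fun t =>
        t.2.1 ≠ t.2.2 ∧ (π (t.1, t.2.1)).1 = (π (t.1, t.2.2)).1).card := by
    refine card_le_card_of_injOn (fun ab => (ab.1.1, ab.1.2, ab.2.2)) ?_ ?_
    · intro ab hab
      rw [mem_coe, mem_filter] at hab
      obtain ⟨-, hne, hfeq⟩ := hab
      have h1 : ab.1.1 = ab.2.1 := (Prod.ext_iff.1 hfeq).1
      have h2 : (π ab.1).1 = (π ab.2).1 := (Prod.ext_iff.1 hfeq).2
      rw [mem_coe, mem_filter]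
      refine ⟨mem_univ _, ?_, ?_⟩
      · intro hc
        exact hne (Prod.ext h1 hc)
      · have e1 : (ab.1.1, ab.1.2) = ab.1 := rfl
        have e2 : (ab.1.1, ab.2.2) = ab.2 := Prod.ext h1 rfl
        rw [e1, e2]
        exact h2
    · intro ab hab ab' hab' h
      rw [mem_coe, mem_filter] at hab hab'
      simp only [Prod.mk.injEq] at h
      obtain ⟨h1, h2, h3⟩ := h
      have ha : ab.1.1 = ab.2.1 := (Prod.ext_iff.1 hab.2.2).1
      have ha' : ab'.1.1 = ab'.2.1 := (Prod.ext_iff.1 hab'.2.2).1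
      refine Prod.ext (Prod.ext h1 h2) (Prod.ext ?_ h3)
      rw [← ha, ← ha', h1]
  calc E.card ≤ (E.image f).card + ((E ×ˢ E).filter fun ab => ab.1 ≠ ab.2 ∧ f ab.1 = f ab.2).card := h1
    _ ≤ _ := Nat.add_le_add (card_le_card himg) hcoll

/-- Cut events and inner events partition the slots of `U`:
`#{(x,c) : x ∈ U, own (π (x,c)) ∉ U} + #{(x,c) : x ∈ U, own (π (x,c)) ∈ U} = |U| · d`. [folklore] -/
theorem card_cutEvents_add_card_inner (π : Equiv.Perm (Fin N × Fin d)) (U : Finset (Fin N)) :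
    ((U ×ˢ (univ : Finset (Fin d))).filter fun p => (π p).1 ∉ U).card +
      ((U ×ˢ (univ : Finset (Fin d))).filter fun p => (π p).1 ∈ U).card = U.card * d := by
  classical
  rw [add_comm, card_filter_add_card_filter_not, card_product, card_univ, Fintype.card_fin]

/-- If no `a`-set of slots of `U` is mapped into the slots of `U`, then fewer than `a` slots of
`U` are ("inner events"). [folklore] -/
theorem card_inner_lt_of_not_bad (π : Equiv.Perm (Fin N × Fin d)) (U : Finset (Fin N)) (a : ℕ)
    (h : ¬ ∃ S ∈ powersetCard a (U ×ˢ (univ : Finset (Fin d))),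
      ∀ p ∈ S, π p ∈ U ×ˢ (univ : Finset (Fin d))) :
    ((U ×ˢ (univ : Finset (Fin d))).filter fun p => (π p).1 ∈ U).card < a := by
  classical
  by_contra hlt
  rw [not_lt] at hlt
  obtain ⟨S, hS, hcard⟩ := exists_subset_card_eq hlt
  refine h ⟨S, mem_powersetCard.2 ⟨hS.trans (filter_subset _ _), hcard⟩, fun p hp => ?_⟩
  have := (mem_filter.1 (hS hp)).2
  exact mem_product.2 ⟨this, mem_univ _⟩

end Cut

end Literature.Combinatorics.Expanders
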